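import Literature.NumberTheory.Automorphic.Liu2021.AppendixC.EichlerShimuraPointwiseTheta
import HarnessLib

/-!
# Eichler–Shimura on points: the per-`δ` summed identity with the Frobenius twist folded in
# ([Liu2021] App. D, proof of Cor. D.9 (p. 139); [DiamondShurman2005] Thm. 8.7.2; [SerreTate1968] §1)

Topic `Literature/NumberTheory/Automorphic/Liu2021/AppendixC`.  THEOREMS only (no def, no instance, no notation, no named fact, no `sorry`).
Cell `hodgecm-mathlib` (D-0151), FLOOR 0, programme F0P5a (D9op road 2′, crux item stmt-HodgeConjecture-24832): piece **(A‴)** = private step L6 of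
the ED. 4 composition of `Cruxes/HLiu418/Lines/F0_D9opRoad2.lean` (F0P5a-p05 (g0) PEN design 2026-08-30T23:43Z), on top of ★ (A′)
`EichlerShimuraPointwiseTheta` (p796543): the summed pairing identity `Σᵢ ᾱ(aᵢ, bᵢ) = ᾱ(x₂, y₂) + n • Σⱼ ᾱ(cⱼ, dⱼ)` in `𝒜_v(κ̄)` where NOW the first two
families of downstairs points are FROBENIUS-TWISTED reductions `F (red ·)`, `F (F (red ·))` — exactly the shape of letter C3
(`RecordCurveCongruenceOnPoints`: `Σ_α {F (red (T_{r₁ α} x))} = {F (F (red (u x)))} + (N w) • Σ_α {red (T_{r₂ α} x)}`).  The twist is kept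
ABSTRACT: any self-map `Fr` of `𝒮_v(κ̄)` and any self-map `s` of `X(Ω)` with `red (s x) = Fr (red x)` (letter Fr: an arithmetic Frobenius `σ`, ★
`IntegralModel.geomReductionMap_smul_of_isAbsArithFrob` p796419) which preserves `∇`-pairs (Galois conjugation does: ★
`AlgPoints.exists_comp_eq_lift_smul_comp`, p795627) — so neither a Galois group nor a Frobenius morphism is imported here.

* `Nabla.sum_pairing_eq_of_multiset_eq_twist` — any transitive carrier `∇X` with a cocycle `β` extended to `αd` (hypotheses of ★
  `Nabla.exists_theta_of_isCocycle`), plus `(Fr, s, hs, hsN)`: from `∇`-pairs `(aᵢ, bᵢ)`, `(x, y)`, `(cⱼ, dⱼ)` of `Ω`-points and the two C3-shaped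
  multiset identities `Σᵢ {Fr (red aᵢ)} = {Fr (Fr (red x))} + Σⱼ n • {red cⱼ}` (and the same for `bᵢ, y, dⱼ`) conclude
  `Σᵢ ᾱ(Fr (red aᵢ), Fr (red bᵢ)) = ᾱ(Fr (Fr (red x)), Fr (Fr (red y))) + n • Σⱼ ᾱ(red cⱼ, red dⱼ)`.
* `Albanese.sum_pairing_eq_of_multiset_eq_twist` / `…_of_isSmoothProper` — the same for an Albanese datum of a smooth projective `X` (cocycle,
  transitivity by ★), `𝒮` proper resp. `𝒮.IsSmoothProper e`.

HC_CM is proved only modulo the 7 printed citations until rung 0 closes; this file is a generic leaf and changes no count.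

## References
* [Liu2021] Y. Liu, *Fourier–Jacobi cycles and arithmetic relative trace formula*, Camb. J. Math. 9 (2021), App. D proof of Cor. D.9 (print
  p. 139), Def. 2.3.
* [DiamondShurman2005] F. Diamond, J. Shurman, *A First Course in Modular Forms*, Thm. 8.7.2 (p. 353).
* [SerreTate1968] J.-P. Serre, J. Tate, *Good reduction of abelian varieties*, Ann. of Math. 88 (1968), §1.
-/

set_option autoImplicit false

noncomputable section

open CategoryTheory CategoryTheory.Limits AlgebraicGeometry MonoidalCategory CartesianMonoidalCategory
open IsDedekindDomain IsDedekindDomain.HeightOneSpectrum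
open scoped NumberField
open Literature.AlgebraicGeometry.Motives (SchemeOver AbelianVariety AlgPoints IntegralModel IsProjectiveOver)
open Literature.NumberTheory.EllipticCurves (genericFibre)
open Literature.NumberTheory.DiophantineGeometry (IsAbelianSchemeModel specialFibreFunctor geomResidueField)

namespace Literature.NumberTheory.Automorphic.Liu2021.AppendixC

variable {K : Type} [Field K] [NumberField K] {v : HeightOneSpectrum (𝓞 K)} {X : SchemeOver K}
  {B : AbelianVariety K} {𝒜 : SchemeOver (valuationSubringAtPrime K v)} [GrpObj 𝒜]

/-! ### §1 Pure bookkeeping: rewriting C3-shaped multiset identities along `red ∘ s = Fr ∘ red` -/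

omit [NumberField K] [GrpObj 𝒜] in
/-- A C3-shaped multiset identity `Σᵢ {Fr (red aᵢ)} = {Fr (Fr (red x))} + Σⱼ n • {red cⱼ}` becomes, along `red (s ·) = Fr (red ·)`, the untwisted
identity `Σᵢ {red (s aᵢ)} = {red (s (s x))} + Σⱼ n • {red cⱼ}` consumed by ★ `Nabla.sum_pairing_eq_of_multiset_eq`. [cite: Liu2021, App. D proof of Cor. D.9 (print p. 139)] -/
theorem multiset_eq_of_twist {P Q : Type} (red : Q → P) (Fr : P → P) (s : Q → Q) (hs : ∀ x, red (s x) = Fr (red x))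
    {I J : Type*} (sI : Finset I) (tJ : Finset J) (a : I → Q) (x : Q) (c : J → Q) (n : ℕ)
    (ha : ∑ i ∈ sI, ({Fr (red (a i))} : Multiset P) = {Fr (Fr (red x))} + ∑ j ∈ tJ, n • ({red (c j)} : Multiset P)) :
    ∑ i ∈ sI, ({red (s (a i))} : Multiset P) = {red (s (s x))} + ∑ j ∈ tJ, n • ({red (c j)} : Multiset P) := by
  simp only [hs]
  exact ha

/-! ### §2 Any carrier `∇X` with a cocycle: the twisted summed identity -/

namespace Nabla

/-- **The per-`δ` pairing identity with the twist folded in** ([Liu2021] App. D proof of Cor. D.9, p. 139; [DiamondShurman2005] Thm. 8.7.2).  Under the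
hypotheses of ★ `Nabla.exists_theta_of_isCocycle` (transitive carrier `∇X`, cocycle `β` extended to `αd`, abelian-scheme model `𝒜`, proper `𝒮`
with surjective `∇`-separating reduction map, `𝔞` with generic fibre `αd`), let `Fr : 𝒮_v(κ̄) → 𝒮_v(κ̄)` and `s : X(Ω) → X(Ω)` satisfy
`red (s x) = Fr (red x)` (letter Fr) with `s` preserving `∇`-pairs.  Then for `∇`-pairs `(aᵢ, bᵢ)` (`i ∈ sI`), `(x, y)`, `(cⱼ, dⱼ)` (`j ∈ tJ`) of
`Ω`-points whose reductions satisfy the two C3-shaped multiset identities `Σᵢ {Fr (red aᵢ)} = {Fr (Fr (red x))} + Σⱼ n • {red cⱼ}` and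
`Σᵢ {Fr (red bᵢ)} = {Fr (Fr (red y))} + Σⱼ n • {red dⱼ}`, one has in `𝒜_v(κ̄)`:
`Σᵢ 𝔞_v(Fr (red aᵢ), Fr (red bᵢ)) = 𝔞_v(Fr (Fr (red x)), Fr (Fr (red y))) + n • Σⱼ 𝔞_v(red cⱼ, red dⱼ)`.
[cite: Liu2021, App. D proof of Cor. D.9 (print p. 139)] [cite: DiamondShurman2005, Thm. 8.7.2 (p. 353)] [cite: SerreTate1968, §1] -/
theorem sum_pairing_eq_of_multiset_eq_twist (N : Nabla X) (hN : N.IsTransitive) (β : N.N ⟶ B.X) (hβ : N.IsCocycle β)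
    (αd : X ⊗ X ⟶ B.X) (hαd : N.incl ≫ αd = β) (h : IsAbelianSchemeModel B v 𝒜)
    (𝒮 : IntegralModel (valuationSubringAtPrime K v) K X) [IsProper 𝒮.total.hom] (𝔞 : 𝒮.total ⊗ 𝒮.total ⟶ 𝒜)
    (h𝔞 : Functor.LaxMonoidal.μ (genericFibre (valuationSubringAtPrime K v) K) 𝒮.total 𝒮.total ≫
        (genericFibre (valuationSubringAtPrime K v) K).map 𝔞 ≫ h.exists_iso.choose.hom = (𝒮.genericIso.hom ⊗ₘ 𝒮.genericIso.hom) ≫ αd)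
    (hH : Function.Surjective 𝒮.geomReductionMap)
    (hπ0 : ∀ p p' : AlgPoints X (AlgebraicClosure (v.adicCompletion K)), 𝒮.geomReductionMap p = 𝒮.geomReductionMap p' →
      ∃ z : AlgPoints N.N (AlgebraicClosure (v.adicCompletion K)), z ≫ N.incl = lift p p')
    (Fr : AlgPoints 𝒮.reductionAt (geomResidueField v) → AlgPoints 𝒮.reductionAt (geomResidueField v))
    (s : AlgPoints X (AlgebraicClosure (v.adicCompletion K)) → AlgPoints X (AlgebraicClosure (v.adicCompletion K)))
    (hs : ∀ x, 𝒮.geomReductionMap (s x) = Fr (𝒮.geomReductionMap x))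
    (hsN : ∀ p q : AlgPoints X (AlgebraicClosure (v.adicCompletion K)),
      (∃ z : AlgPoints N.N (AlgebraicClosure (v.adicCompletion K)), z ≫ N.incl = lift p q) →
      ∃ z : AlgPoints N.N (AlgebraicClosure (v.adicCompletion K)), z ≫ N.incl = lift (s p) (s q))
    {I J : Type*} (sI : Finset I) (tJ : Finset J)
    (a b : I → AlgPoints X (AlgebraicClosure (v.adicCompletion K)))
    (hab : ∀ i ∈ sI, ∃ z : AlgPoints N.N (AlgebraicClosure (v.adicCompletion K)), z ≫ N.incl = lift (a i) (b i))
    (x y : AlgPoints X (AlgebraicClosure (v.adicCompletion K)))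
    (hxy : ∃ z : AlgPoints N.N (AlgebraicClosure (v.adicCompletion K)), z ≫ N.incl = lift x y)
    (c d : J → AlgPoints X (AlgebraicClosure (v.adicCompletion K)))
    (hcd : ∀ j ∈ tJ, ∃ z : AlgPoints N.N (AlgebraicClosure (v.adicCompletion K)), z ≫ N.incl = lift (c j) (d j)) (n : ℕ)
    (ha : ∑ i ∈ sI, ({Fr (𝒮.geomReductionMap (a i))} : Multiset (AlgPoints 𝒮.reductionAt (geomResidueField v))) =
      {Fr (Fr (𝒮.geomReductionMap x))} +
        ∑ j ∈ tJ, n • ({𝒮.geomReductionMap (c j)} : Multiset (AlgPoints 𝒮.reductionAt (geomResidueField v))))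
    (hb : ∑ i ∈ sI, ({Fr (𝒮.geomReductionMap (b i))} : Multiset (AlgPoints 𝒮.reductionAt (geomResidueField v))) =
      {Fr (Fr (𝒮.geomReductionMap y))} +
        ∑ j ∈ tJ, n • ({𝒮.geomReductionMap (d j)} : Multiset (AlgPoints 𝒮.reductionAt (geomResidueField v)))) :
    ∑ i ∈ sI, (Additive.ofMul (AlgPoints.map ((specialFibreFunctor v).map 𝔞)
        (lift (Fr (𝒮.geomReductionMap (a i))) (Fr (𝒮.geomReductionMap (b i))) ≫
          Functor.LaxMonoidal.μ (specialFibreFunctor v) 𝒮.total 𝒮.total)) : h.specialFibre.geomPoints) =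
      (Additive.ofMul (AlgPoints.map ((specialFibreFunctor v).map 𝔞)
          (lift (Fr (Fr (𝒮.geomReductionMap x))) (Fr (Fr (𝒮.geomReductionMap y))) ≫
            Functor.LaxMonoidal.μ (specialFibreFunctor v) 𝒮.total 𝒮.total)) : h.specialFibre.geomPoints) +
      n • ∑ j ∈ tJ, (Additive.ofMul (AlgPoints.map ((specialFibreFunctor v).map 𝔞)
        (lift (𝒮.geomReductionMap (c j)) (𝒮.geomReductionMap (d j)) ≫
          Functor.LaxMonoidal.μ (specialFibreFunctor v) 𝒮.total 𝒮.total)) : h.specialFibre.geomPoints) := by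
  -- untwist: `Fr (red ·) = red (s ·)`, `Fr (Fr (red ·)) = red (s (s ·))`
  simp only [← hs] at ha hb ⊢
  exact N.sum_pairing_eq_of_multiset_eq hN β hβ αd hαd h 𝒮 𝔞 h𝔞 hH hπ0 sI tJ (fun i => s (a i)) (fun i => s (b i))
    (fun i hi => hsN _ _ (hab i hi)) (s (s x)) (s (s y)) (hsN _ _ (hsN _ _ hxy)) c d hcd n ha hb

end Nabla

/-! ### §3 The Albanese datum of a smooth projective scheme -/

namespace Albanese

/-- **The twisted per-`δ` identity for the Albanese difference morphism** (cocycle ★ `Albanese.isCocycle_of_isProjectiveOver'`, transitivity ★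
`Nabla.isTransitive_of_isProjectiveOver` discharged): see `Nabla.sum_pairing_eq_of_multiset_eq_twist`.
[cite: Liu2021, Def. 2.3 (l. 1202–1208) and App. D proof of Cor. D.9 (print p. 139)] [cite: DiamondShurman2005, Thm. 8.7.2 (p. 353)] -/
theorem sum_pairing_eq_of_multiset_eq_twist {dX : ℕ} [SmoothOfRelativeDimension dX X.hom] (hX : IsProjectiveOver X) (aX : Albanese X)
    (αd : X ⊗ X ⟶ aX.Alb.X) (hαd : aX.nabla.incl ≫ αd = aX.α) (h : IsAbelianSchemeModel aX.Alb v 𝒜)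
    (𝒮 : IntegralModel (valuationSubringAtPrime K v) K X) [IsProper 𝒮.total.hom] (𝔞 : 𝒮.total ⊗ 𝒮.total ⟶ 𝒜)
    (h𝔞 : Functor.LaxMonoidal.μ (genericFibre (valuationSubringAtPrime K v) K) 𝒮.total 𝒮.total ≫
        (genericFibre (valuationSubringAtPrime K v) K).map 𝔞 ≫ h.exists_iso.choose.hom = (𝒮.genericIso.hom ⊗ₘ 𝒮.genericIso.hom) ≫ αd)
    (hH : Function.Surjective 𝒮.geomReductionMap)
    (hπ0 : ∀ p p' : AlgPoints X (AlgebraicClosure (v.adicCompletion K)), 𝒮.geomReductionMap p = 𝒮.geomReductionMap p' →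
      ∃ z : AlgPoints aX.nabla.N (AlgebraicClosure (v.adicCompletion K)), z ≫ aX.nabla.incl = lift p p')
    (Fr : AlgPoints 𝒮.reductionAt (geomResidueField v) → AlgPoints 𝒮.reductionAt (geomResidueField v))
    (s : AlgPoints X (AlgebraicClosure (v.adicCompletion K)) → AlgPoints X (AlgebraicClosure (v.adicCompletion K)))
    (hs : ∀ x, 𝒮.geomReductionMap (s x) = Fr (𝒮.geomReductionMap x))
    (hsN : ∀ p q : AlgPoints X (AlgebraicClosure (v.adicCompletion K)),
      (∃ z : AlgPoints aX.nabla.N (AlgebraicClosure (v.adicCompletion K)), z ≫ aX.nabla.incl = lift p q) →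
      ∃ z : AlgPoints aX.nabla.N (AlgebraicClosure (v.adicCompletion K)), z ≫ aX.nabla.incl = lift (s p) (s q))
    {I J : Type*} (sI : Finset I) (tJ : Finset J)
    (a b : I → AlgPoints X (AlgebraicClosure (v.adicCompletion K)))
    (hab : ∀ i ∈ sI, ∃ z : AlgPoints aX.nabla.N (AlgebraicClosure (v.adicCompletion K)), z ≫ aX.nabla.incl = lift (a i) (b i))
    (x y : AlgPoints X (AlgebraicClosure (v.adicCompletion K)))
    (hxy : ∃ z : AlgPoints aX.nabla.N (AlgebraicClosure (v.adicCompletion K)), z ≫ aX.nabla.incl = lift x y)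
    (c d : J → AlgPoints X (AlgebraicClosure (v.adicCompletion K)))
    (hcd : ∀ j ∈ tJ, ∃ z : AlgPoints aX.nabla.N (AlgebraicClosure (v.adicCompletion K)), z ≫ aX.nabla.incl = lift (c j) (d j)) (n : ℕ)
    (ha : ∑ i ∈ sI, ({Fr (𝒮.geomReductionMap (a i))} : Multiset (AlgPoints 𝒮.reductionAt (geomResidueField v))) =
      {Fr (Fr (𝒮.geomReductionMap x))} +
        ∑ j ∈ tJ, n • ({𝒮.geomReductionMap (c j)} : Multiset (AlgPoints 𝒮.reductionAt (geomResidueField v))))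
    (hb : ∑ i ∈ sI, ({Fr (𝒮.geomReductionMap (b i))} : Multiset (AlgPoints 𝒮.reductionAt (geomResidueField v))) =
      {Fr (Fr (𝒮.geomReductionMap y))} +
        ∑ j ∈ tJ, n • ({𝒮.geomReductionMap (d j)} : Multiset (AlgPoints 𝒮.reductionAt (geomResidueField v)))) :
    ∑ i ∈ sI, (Additive.ofMul (AlgPoints.map ((specialFibreFunctor v).map 𝔞)
        (lift (Fr (𝒮.geomReductionMap (a i))) (Fr (𝒮.geomReductionMap (b i))) ≫
          Functor.LaxMonoidal.μ (specialFibreFunctor v) 𝒮.total 𝒮.total)) : h.specialFibre.geomPoints) =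
      (Additive.ofMul (AlgPoints.map ((specialFibreFunctor v).map 𝔞)
          (lift (Fr (Fr (𝒮.geomReductionMap x))) (Fr (Fr (𝒮.geomReductionMap y))) ≫
            Functor.LaxMonoidal.μ (specialFibreFunctor v) 𝒮.total 𝒮.total)) : h.specialFibre.geomPoints) +
      n • ∑ j ∈ tJ, (Additive.ofMul (AlgPoints.map ((specialFibreFunctor v).map 𝔞)
        (lift (𝒮.geomReductionMap (c j)) (𝒮.geomReductionMap (d j)) ≫
          Functor.LaxMonoidal.μ (specialFibreFunctor v) 𝒮.total 𝒮.total)) : h.specialFibre.geomPoints) :=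
  aX.nabla.sum_pairing_eq_of_multiset_eq_twist (Nabla.isTransitive_of_isProjectiveOver (d := dX) hX aX.nabla) aX.α
    (Albanese.isCocycle_of_isProjectiveOver' (d := dX) hX aX) αd hαd h 𝒮 𝔞 h𝔞 hH hπ0 Fr s hs hsN sI tJ a b hab x y hxy c d hcd n ha hb

/-- The same with the letter's binder `h𝒮 : 𝒮.IsSmoothProper e` supplying properness (`haveI := h𝒮.2`).
[cite: Liu2021, Def. 2.3 (l. 1202–1208) and App. D proof of Cor. D.9 (print p. 139)] [cite: DiamondShurman2005, Thm. 8.7.2 (p. 353)] -/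
theorem sum_pairing_eq_of_multiset_eq_twist_of_isSmoothProper {dX : ℕ} [SmoothOfRelativeDimension dX X.hom] (hX : IsProjectiveOver X)
    (aX : Albanese X) (αd : X ⊗ X ⟶ aX.Alb.X) (hαd : aX.nabla.incl ≫ αd = aX.α) (h : IsAbelianSchemeModel aX.Alb v 𝒜)
    (𝒮 : IntegralModel (valuationSubringAtPrime K v) K X) {e : ℕ} (h𝒮 : 𝒮.IsSmoothProper e) (𝔞 : 𝒮.total ⊗ 𝒮.total ⟶ 𝒜)
    (h𝔞 : Functor.LaxMonoidal.μ (genericFibre (valuationSubringAtPrime K v) K) 𝒮.total 𝒮.total ≫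
        (genericFibre (valuationSubringAtPrime K v) K).map 𝔞 ≫ h.exists_iso.choose.hom = (𝒮.genericIso.hom ⊗ₘ 𝒮.genericIso.hom) ≫ αd)
    (hH : Function.Surjective (haveI := h𝒮.2; 𝒮.geomReductionMap))
    (hπ0 : ∀ p p' : AlgPoints X (AlgebraicClosure (v.adicCompletion K)),
      (haveI := h𝒮.2; 𝒮.geomReductionMap p = 𝒮.geomReductionMap p') →
      ∃ z : AlgPoints aX.nabla.N (AlgebraicClosure (v.adicCompletion K)), z ≫ aX.nabla.incl = lift p p')
    (Fr : AlgPoints 𝒮.reductionAt (geomResidueField v) → AlgPoints 𝒮.reductionAt (geomResidueField v))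
    (s : AlgPoints X (AlgebraicClosure (v.adicCompletion K)) → AlgPoints X (AlgebraicClosure (v.adicCompletion K)))
    (hs : ∀ x, (haveI := h𝒮.2; 𝒮.geomReductionMap (s x)) = Fr (haveI := h𝒮.2; 𝒮.geomReductionMap x))
    (hsN : ∀ p q : AlgPoints X (AlgebraicClosure (v.adicCompletion K)),
      (∃ z : AlgPoints aX.nabla.N (AlgebraicClosure (v.adicCompletion K)), z ≫ aX.nabla.incl = lift p q) →
      ∃ z : AlgPoints aX.nabla.N (AlgebraicClosure (v.adicCompletion K)), z ≫ aX.nabla.incl = lift (s p) (s q))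
    {I J : Type*} (sI : Finset I) (tJ : Finset J)
    (a b : I → AlgPoints X (AlgebraicClosure (v.adicCompletion K)))
    (hab : ∀ i ∈ sI, ∃ z : AlgPoints aX.nabla.N (AlgebraicClosure (v.adicCompletion K)), z ≫ aX.nabla.incl = lift (a i) (b i))
    (x y : AlgPoints X (AlgebraicClosure (v.adicCompletion K)))
    (hxy : ∃ z : AlgPoints aX.nabla.N (AlgebraicClosure (v.adicCompletion K)), z ≫ aX.nabla.incl = lift x y)
    (c d : J → AlgPoints X (AlgebraicClosure (v.adicCompletion K)))
    (hcd : ∀ j ∈ tJ, ∃ z : AlgPoints aX.nabla.N (AlgebraicClosure (v.adicCompletion K)), z ≫ aX.nabla.incl = lift (c j) (d j)) (n : ℕ)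
    (ha : ∑ i ∈ sI, ({Fr (haveI := h𝒮.2; 𝒮.geomReductionMap (a i))} : Multiset (AlgPoints 𝒮.reductionAt (geomResidueField v))) =
      {Fr (Fr (haveI := h𝒮.2; 𝒮.geomReductionMap x))} +
        ∑ j ∈ tJ, n • ({(haveI := h𝒮.2; 𝒮.geomReductionMap (c j))} : Multiset (AlgPoints 𝒮.reductionAt (geomResidueField v))))
    (hb : ∑ i ∈ sI, ({Fr (haveI := h𝒮.2; 𝒮.geomReductionMap (b i))} : Multiset (AlgPoints 𝒮.reductionAt (geomResidueField v))) =
      {Fr (Fr (haveI := h𝒮.2; 𝒮.geomReductionMap y))} +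
        ∑ j ∈ tJ, n • ({(haveI := h𝒮.2; 𝒮.geomReductionMap (d j))} : Multiset (AlgPoints 𝒮.reductionAt (geomResidueField v)))) :
    ∑ i ∈ sI, (Additive.ofMul (AlgPoints.map ((specialFibreFunctor v).map 𝔞)
        (lift (Fr (haveI := h𝒮.2; 𝒮.geomReductionMap (a i))) (Fr (haveI := h𝒮.2; 𝒮.geomReductionMap (b i))) ≫
          Functor.LaxMonoidal.μ (specialFibreFunctor v) 𝒮.total 𝒮.total)) : h.specialFibre.geomPoints) =
      (Additive.ofMul (AlgPoints.map ((specialFibreFunctor v).map 𝔞)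
          (lift (Fr (Fr (haveI := h𝒮.2; 𝒮.geomReductionMap x))) (Fr (Fr (haveI := h𝒮.2; 𝒮.geomReductionMap y))) ≫
            Functor.LaxMonoidal.μ (specialFibreFunctor v) 𝒮.total 𝒮.total)) : h.specialFibre.geomPoints) +
      n • ∑ j ∈ tJ, (Additive.ofMul (AlgPoints.map ((specialFibreFunctor v).map 𝔞)
        (lift (haveI := h𝒮.2; 𝒮.geomReductionMap (c j)) (haveI := h𝒮.2; 𝒮.geomReductionMap (d j)) ≫
          Functor.LaxMonoidal.μ (specialFibreFunctor v) 𝒮.total 𝒮.total)) : h.specialFibre.geomPoints) := by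
  haveI := h𝒮.2
  exact aX.sum_pairing_eq_of_multiset_eq_twist (dX := dX) hX αd hαd h 𝒮 𝔞 h𝔞 hH hπ0 Fr s hs hsN sI tJ a b hab x y hxy c d hcd n ha hb

end Albanese

end Literature.NumberTheory.Automorphic.Liu2021.AppendixC

end
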